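import Mathlib
import Summits.Ventures.PercRepro2.HCov
import Summits.Ventures.PercRepro2.ExploreA3
import Summits.Ventures.PercRepro2.OrderPreservation
import Summits.Ventures.PercRepro2.SameClusterAvoid
import Summits.Ventures.PercRepro2.RootLeafUSigns
import Summits.Ventures.PercRepro2.RootLeafUYBF
import Summits.Ventures.PercRepro2.RootLeafUYBFW

/-!
# (G4-u): `(F_W)` from the single conditional-multiplicativity statement `(b)`
(blind cell PercRepro2, p4 g11; proofs/P4-G11-B.md)

RootLeafUYBFW landed `(F_W) := (Z + W)·D·M + W·Y_N·B₀ − D·B·Y ≥ 0 ⟹ (YB) ≥ 0 ⟹ 0 ≤ T2oL`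
(`W = P(R)`, `R = {u ↮ a₂, u ↮ c}`, `Z = P(Q)`, `Q = {u ↮ a₂}`, `D = P(PD)`, `PD = R ∩ {a₂ ↮ c}`,
`Y = P(R, oL)`, `B = P(Q, bL)`, `B₀ = P(Q, a₂ ↮ c, bL)`, `Y_N = P(PD, oL)`, `M = P(T, oL, bL)`,
`T = R ∩ {a₂ ↔ c}`).  Here `(F_W)` is reduced, for EVERY instance (no `M = 0` assumption), to the
one statement (`X̄ = {a₂ ↮ c}`, `ōL = {u ↮ o}`)

  **`(b)`: `P(R, X̄, ōL) · P(Q, bL, ōL) · P(R, oL) ≤ P(Q, X̄, bL, ōL) · P(R, X̄, oL) · P(R, ōL)`**,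

in conditional form `P(X̄ | R, ōL) ≤ P(X̄ | Q, bL, ōL) · P(X̄ | R, oL)`: BHK06 Thm 1.3 gives
`P(X̄ | R, ōL) ≤ P(X̄ | Q, bL, ōL)`, and `(b)` is that bound improved by the factor `P(X̄ | R, oL)`.
The reduction is the exact identity (`Ȳ = P(R, ōL) = W − Y`, `fw_b_identity`)

  `Ȳ · (F_W) = α · δ_o + W · β + Ȳ · M · ((Z + W)·D − W·Y_N)`,

with `α = W·P(Q, oL, bL) − Y·B ≥ 0` (positive association of the cluster of `u` given `u ↮ a₂`,
applied twice: `P(oL | R) ≤ P(oL | Q) ≤ P(oL | Q, bL)`; `a_ineq`), `δ_o = t·Y_N − D·Y_t ≥ 0`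
(BHK06 Thm 1.4 on `R`, `ToL_mul_D_le`), `β ≥ 0` the cleared `(b)`, and the last term a product of
masses (`Y_N ≤ D`).  The degenerate branch `Ȳ = 0` (`o ∈ L` almost surely on `R`) is
`(F_W) = D·B₁·(D + t + t′)` (`fw_of_b_alg`).  Census (own exact code, p4 g11): `(b)` has
0 violations on 1,600 random instances of the tie class `M = 0` of `(F_W)` (n = 5–7, six palettes)
and FAILS off that class (it reads `x² ≥ x` when `o, b` are irrelevant) — so on the class where
`(F_W)` is tight it is exactly `(b)`, and `(b)` is the statement left to prove.
-/

namespace Summit.Ventures.PercRepro2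

open UnionCluster CovForm

namespace RootLeafU

namespace YBF

section AlgebraB

variable {R : Type*} [Field R] [LinearOrder R] [IsStrictOrderedRing R]

omit [LinearOrder R] [IsStrictOrderedRing R] in
/-- The exact identity behind the reduction, in the eleven pattern masses
(`D, t, t′` = `P(PD), P(T), P(T′)`; `Y_N, Y_t` their `o ∈ L` parts; `b_N, B₁, b′` their `b ∈ L`
parts; `M_N, M, M′` their `o, b ∈ L` parts): with `Ȳ = (D + t) − (Y_N + Y_t)`,
`Ȳ·(F_W) = α·δ_o + W·β + Ȳ·M·((Z + W)·D − W·Y_N)`. -/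
lemma fw_b_identity (D t tp YN Yt bN B1 bp MN M Mp : R) :
    ((D + t) - (YN + Yt)) *
        ((D + t + tp + (D + t)) * D * M + (D + t) * YN * (bN + bp) -
          D * (bN + B1 + bp) * (YN + Yt)) =
      ((D + t) * (MN + M + Mp) - (YN + Yt) * (bN + B1 + bp)) * (YN * t - Yt * D) +
        (D + t) * ((bN - MN + (bp - Mp)) * YN * ((D + t) - (YN + Yt)) -
          (D - YN) * ((bN + B1 + bp) - (MN + M + Mp)) * (YN + Yt)) +
        ((D + t) - (YN + Yt)) * M * ((D + t + tp + (D + t)) * D - (D + t) * YN) := by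
  ring

/-- **The algebra of `(F_W)` from `(a)`, `δ_o ≥ 0` and `(b)`**: `ha` is `(a)`
`Y·B ≤ W·P(Q, oL, bL)`, `hδ` is `Y_t·D ≤ Y_N·t`, `hb` is the cleared `(b)`; `hMB` is the mass bound
`P(T, bL) − P(T, oL, bL) ≤ P(R) − P(R, oL)`. -/
lemma fw_of_b_alg {D t tp YN Yt bN B1 bp MN M Mp : R} (hD : 0 ≤ D) (ht : 0 ≤ t) (htp : 0 ≤ tp)
    (hB1 : 0 ≤ B1) (hM : 0 ≤ M)
    (hYND : YN ≤ D) (hYtt : Yt ≤ t) (hMB1 : M ≤ B1) (hMB : B1 - M ≤ (D + t) - (YN + Yt))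
    (ha : (YN + Yt) * (bN + B1 + bp) ≤ (D + t) * (MN + M + Mp))
    (hδ : Yt * D ≤ YN * t)
    (hb : (D - YN) * ((bN + B1 + bp) - (MN + M + Mp)) * (YN + Yt) ≤
      (bN - MN + (bp - Mp)) * YN * ((D + t) - (YN + Yt))) :
    D * (bN + B1 + bp) * (YN + Yt) ≤
      (D + t + tp + (D + t)) * D * M + (D + t) * YN * (bN + bp) := by
  have hYbar : 0 ≤ (D + t) - (YN + Yt) := by linarith
  have hW : 0 ≤ D + t := by linarith
  have hcoef : 0 ≤ (D + t + tp + (D + t)) * D - (D + t) * YN := by nlinarith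
  have hprod : 0 ≤ ((D + t) - (YN + Yt)) *
      ((D + t + tp + (D + t)) * D * M + (D + t) * YN * (bN + bp) -
        D * (bN + B1 + bp) * (YN + Yt)) := by
    rw [fw_b_identity]
    have h1 : 0 ≤ ((D + t) * (MN + M + Mp) - (YN + Yt) * (bN + B1 + bp)) * (YN * t - Yt * D) :=
      mul_nonneg (by linarith) (by linarith)
    have h2 : 0 ≤ (D + t) * ((bN - MN + (bp - Mp)) * YN * ((D + t) - (YN + Yt)) -
        (D - YN) * ((bN + B1 + bp) - (MN + M + Mp)) * (YN + Yt)) :=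
      mul_nonneg hW (by linarith)
    have h3 : 0 ≤ ((D + t) - (YN + Yt)) * M * ((D + t + tp + (D + t)) * D - (D + t) * YN) :=
      mul_nonneg (mul_nonneg hYbar hM) hcoef
    linarith
  rcases eq_or_lt_of_le hYbar with h0 | hpos
  · -- `Ȳ = 0`: `Y_N = D`, `Y_t = t`, `M = B₁`, and `(F_W) = D·B₁·(D + t + t′)`
    have hYN' : YN = D := by linarith
    have hYt' : Yt = t := by linarith
    have hM' : M = B1 := by linarith
    have key : (D + t + tp + (D + t)) * D * M + (D + t) * YN * (bN + bp) -
        D * (bN + B1 + bp) * (YN + Yt) = D * B1 * (D + t + tp) := by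
      rw [hYN', hYt', hM']
      ring
    have hpos' : 0 ≤ D * B1 * (D + t + tp) :=
      mul_nonneg (mul_nonneg hD hB1) (by linarith)
    linarith
  · have := (mul_nonneg_iff_of_pos_left hpos).1 hprod
    linarith

end AlgebraB

section ReductionB

variable {V : Type*} {E : Type*} [Fintype E] [DecidableEq E] [Fintype V] [DecidableEq V]
  {R : Type*} [Field R] [LinearOrder R] [IsStrictOrderedRing R]

variable (p : E → R) (ends : E → Sym2 V) (o a₂ c b u : V)

omit [Fintype E] [DecidableEq E] [Fintype V] [DecidableEq V] in
/-- `{u ↮ a₂} = {a₂ ↮ u}`. -/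
lemma avoid_u_a₂_eq : avoidAll ends u {a₂} = avoidAll ends a₂ {u} := by
  rw [avoidAll_singleton_eq, avoidAll_singleton_eq, connEvent_comm]

omit [Fintype E] [DecidableEq E] [Fintype V] in
/-- `R = Q ∩ {u ↮ c}` (with `Q` written from `u`). -/
lemma avoid_pair_eq : avoidAll ends u {a₂, c} = avoidAll ends u {a₂} ∩ (connEvent ends u c)ᶜ := by
  ext ω
  simp only [Set.mem_inter_iff, mem_avoidAll, Finset.mem_insert, Finset.mem_singleton,
    forall_eq_or_imp, forall_eq, Set.mem_compl_iff, mem_connEvent]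

omit [Fintype E] [DecidableEq E] [Fintype V] in
/-- `T ⊆ R`. -/
lemma T_subset_R : TEvent ends u a₂ c ⊆ avoidAll ends u {a₂, c} := by
  rw [ISplit.T_eq_R_inter]
  exact Set.inter_subset_left

/-- **`(a)`: `P(R, oL) · P(Q, bL) ≤ P(R) · P(Q, oL, bL)`** — positive association of the cluster
of `u` given `u ↮ a₂` (BHK06 Thm 1.3, `bhk_same_cluster_events_avoid`), twice:
`P(oL | R) ≤ P(oL | Q)` (the pair `oL, cL`) and `P(oL | Q) ≤ P(oL | Q, bL)` (the pair `oL, bL`). -/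
lemma a_ineq (hp : IsProbVec p) :
    prob p (avoidAll ends u {a₂, c} ∩ connEvent ends u o) *
        prob p (avoidAll ends a₂ {u} ∩ connEvent ends u b) ≤
      prob p (avoidAll ends u {a₂, c}) *
        prob p (avoidAll ends a₂ {u} ∩ (connEvent ends u o ∩ connEvent ends u b)) := by
  rw [← avoid_u_a₂_eq]
  -- positive association on `Q = {u ↮ a₂}`: the pairs `(oL, bL)` and `(oL, cL)`
  have h1 := bhk_same_cluster_events_avoid p hp ends u {a₂} (isUpperSet_mem_setOf o)
    (isUpperSet_mem_setOf b)
  have h2 := bhk_same_cluster_events_avoid p hp ends u {a₂} (isUpperSet_mem_setOf o)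
    (isUpperSet_mem_setOf c)
  rw [clusterInEvent_mem_inter_eq, ExploreA3.clusterInEvent_mem_eq,
    ExploreA3.clusterInEvent_mem_eq] at h1 h2
  -- masses of `R = Q ∩ cLᶜ`
  have s1 := prob_inter_add_prob_inter_compl p (avoidAll ends u {a₂}) (connEvent ends u c)
  have s2 := prob_inter_add_prob_inter_compl p (avoidAll ends u {a₂} ∩ connEvent ends u o)
    (connEvent ends u c)
  have eR : avoidAll ends u {a₂, c} ∩ connEvent ends u o =
      avoidAll ends u {a₂} ∩ connEvent ends u o ∩ (connEvent ends u c)ᶜ := by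
    rw [avoid_pair_eq]
    ext ω; simp only [Set.mem_inter_iff]; tauto
  have eR0 : avoidAll ends u {a₂, c} = avoidAll ends u {a₂} ∩ (connEvent ends u c)ᶜ :=
    avoid_pair_eq ends a₂ c u
  have e1 : connEvent ends u o ∩ avoidAll ends u {a₂} =
      avoidAll ends u {a₂} ∩ connEvent ends u o := Set.inter_comm _ _
  have e2 : connEvent ends u b ∩ avoidAll ends u {a₂} =
      avoidAll ends u {a₂} ∩ connEvent ends u b := Set.inter_comm _ _
  have e3 : connEvent ends u o ∩ connEvent ends u b ∩ avoidAll ends u {a₂} =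
      avoidAll ends u {a₂} ∩ (connEvent ends u o ∩ connEvent ends u b) := Set.inter_comm _ _
  have e4 : connEvent ends u c ∩ avoidAll ends u {a₂} =
      avoidAll ends u {a₂} ∩ connEvent ends u c := Set.inter_comm _ _
  have e5 : connEvent ends u o ∩ connEvent ends u c ∩ avoidAll ends u {a₂} =
      avoidAll ends u {a₂} ∩ connEvent ends u o ∩ connEvent ends u c := by
    ext ω; simp only [Set.mem_inter_iff]; tauto
  rw [e1, e2, e3] at h1
  rw [e1, e4, e5] at h2
  rw [eR, eR0]
  -- abbreviations
  set z := prob p (avoidAll ends u {a₂}) with hz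
  set x := prob p (avoidAll ends u {a₂} ∩ connEvent ends u o) with hx
  set zc := prob p (avoidAll ends u {a₂} ∩ connEvent ends u c) with hzc
  set xc := prob p (avoidAll ends u {a₂} ∩ connEvent ends u o ∩ connEvent ends u c) with hxc
  set w := prob p (avoidAll ends u {a₂} ∩ (connEvent ends u c)ᶜ) with hw
  set y := prob p (avoidAll ends u {a₂} ∩ connEvent ends u o ∩ (connEvent ends u c)ᶜ) with hy
  set β := prob p (avoidAll ends u {a₂} ∩ connEvent ends u b) with hβ
  set βo := prob p (avoidAll ends u {a₂} ∩ (connEvent ends u o ∩ connEvent ends u b)) with hβo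
  -- `(a1)`: `y·z ≤ x·w` from `h2 : x·zc ≤ xc·z`, `y = x − xc`, `w = z − zc`
  have ha1 : y * z ≤ x * w := by
    have ey : y * z = x * z - xc * z := by rw [← s2]; ring
    have ew : x * w = x * z - x * zc := by rw [← s1]; ring
    linarith [h2, ey, ew]
  -- `(a2)`: `x·β ≤ βo·z` is `h1`
  have hz0 : 0 ≤ z := prob_nonneg hp _
  have hw0 : 0 ≤ w := prob_nonneg hp _
  have hβ0 : 0 ≤ β := prob_nonneg hp _
  have hβo0 : 0 ≤ βo := prob_nonneg hp _
  have hy0 : 0 ≤ y := prob_nonneg hp _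
  have hyz : y ≤ z := prob_mono hp (Set.inter_subset_left.trans Set.inter_subset_left)
  rcases eq_or_lt_of_le hz0 with hz' | hzpos
  · have hy' : y = 0 := le_antisymm (hz' ▸ hyz) hy0
    rw [hy', zero_mul]
    exact mul_nonneg hw0 hβo0
  · have key : z * (y * β) ≤ z * (w * βo) := by
      have t1 : y * z * β ≤ x * w * β := mul_le_mul_of_nonneg_right ha1 hβ0
      have t2 : w * (x * β) ≤ w * (βo * z) := mul_le_mul_of_nonneg_left h1 hw0
      nlinarith [t1, t2]
    exact le_of_mul_le_mul_left key hzpos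

/-- **`(F_W)` from `(b)`**: for every instance,
`(b)`: `P(PD, ōL)·P(Q, bL, ōL)·P(R, oL) ≤ (P(PD, bL, ōL) + P(T′, bL, ōL))·P(PD, oL)·P(R, ōL)`
(`T′ = Q ∩ {u ↔ c}`, so `PD ⊔ T′ = Q ∩ {a₂ ↮ c}`) implies the hypothesis `(F_W)` of
`YB_nonneg_of_FW`. -/
theorem FW_of_b (hp : IsProbVec p)
    (hb : prob p (PDEvent ends u a₂ c ∩ (connEvent ends u o)ᶜ) *
        prob p (avoidAll ends a₂ {u} ∩ connEvent ends u b ∩ (connEvent ends u o)ᶜ) *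
        prob p (avoidAll ends u {a₂, c} ∩ connEvent ends u o) ≤
      (prob p (PDEvent ends u a₂ c ∩ connEvent ends u b ∩ (connEvent ends u o)ᶜ) +
          prob p (TEvent ends a₂ u c ∩ connEvent ends u b ∩ (connEvent ends u o)ᶜ)) *
        prob p (PDEvent ends u a₂ c ∩ connEvent ends u o) *
        prob p (avoidAll ends u {a₂, c} ∩ (connEvent ends u o)ᶜ)) :
    prob p (PDEvent ends u a₂ c) * prob p (avoidAll ends a₂ {u} ∩ connEvent ends u b) *
        prob p (avoidAll ends u {a₂, c} ∩ connEvent ends u o) ≤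
      (prob p (avoidAll ends a₂ {u}) + prob p (avoidAll ends u {a₂, c})) * prob p (PDEvent ends u a₂ c) *
          prob p (TEvent ends u a₂ c ∩ (connEvent ends u o ∩ connEvent ends u b)) +
        prob p (avoidAll ends u {a₂, c}) * prob p (PDEvent ends u a₂ c ∩ connEvent ends u o) *
          (prob p (PDEvent ends u a₂ c ∩ connEvent ends u b) +
            prob p (TEvent ends a₂ u c ∩ connEvent ends u b)) := by
  -- the splits `R = PD ⊔ T`, `Q = PD ⊔ T ⊔ T′`
  have hW : prob p (avoidAll ends u {a₂, c}) =
      prob p (PDEvent ends u a₂ c) + prob p (TEvent ends u a₂ c) := by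
    have h' := ISplit.prob_PD_add_T p ends u a₂ c Set.univ
    simp only [Set.inter_univ] at h'
    exact h'.symm
  have hY : prob p (avoidAll ends u {a₂, c} ∩ connEvent ends u o) =
      prob p (PDEvent ends u a₂ c ∩ connEvent ends u o) +
        prob p (TEvent ends u a₂ c ∩ connEvent ends u o) :=
    (ISplit.prob_PD_add_T p ends u a₂ c (connEvent ends u o)).symm
  have hZ := Qsplit_univ p ends u a₂ c
  have hB := Qsplit p ends u a₂ c (connEvent ends u b)
  have hBo := Qsplit p ends u a₂ c (connEvent ends u o ∩ connEvent ends u b)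
  -- the complement masses of `(b)`
  have c1 := prob_inter_add_prob_inter_compl p (PDEvent ends u a₂ c) (connEvent ends u o)
  have c2 := prob_inter_add_prob_inter_compl p (avoidAll ends a₂ {u} ∩ connEvent ends u b)
    (connEvent ends u o)
  have c3 := prob_inter_add_prob_inter_compl p (avoidAll ends u {a₂, c}) (connEvent ends u o)
  have c4 := prob_inter_add_prob_inter_compl p (PDEvent ends u a₂ c ∩ connEvent ends u b)
    (connEvent ends u o)
  have c5 := prob_inter_add_prob_inter_compl p (TEvent ends a₂ u c ∩ connEvent ends u b)
    (connEvent ends u o)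
  have c6 := prob_inter_add_prob_inter_compl p (TEvent ends u a₂ c ∩ connEvent ends u b)
    (connEvent ends u o)
  have e2 : avoidAll ends a₂ {u} ∩ connEvent ends u b ∩ connEvent ends u o =
      avoidAll ends a₂ {u} ∩ (connEvent ends u o ∩ connEvent ends u b) := by
    ext ω; simp only [Set.mem_inter_iff]; tauto
  have e4 : PDEvent ends u a₂ c ∩ connEvent ends u b ∩ connEvent ends u o =
      PDEvent ends u a₂ c ∩ (connEvent ends u o ∩ connEvent ends u b) := by
    ext ω; simp only [Set.mem_inter_iff]; tauto
  have e5 : TEvent ends a₂ u c ∩ connEvent ends u b ∩ connEvent ends u o =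
      TEvent ends a₂ u c ∩ (connEvent ends u o ∩ connEvent ends u b) := by
    ext ω; simp only [Set.mem_inter_iff]; tauto
  have e6 : TEvent ends u a₂ c ∩ connEvent ends u b ∩ connEvent ends u o =
      TEvent ends u a₂ c ∩ (connEvent ends u o ∩ connEvent ends u b) := by
    ext ω; simp only [Set.mem_inter_iff]; tauto
  rw [e2] at c2
  rw [e4] at c4
  rw [e5] at c5
  rw [e6] at c6
  -- `(a)`, `δ_o ≥ 0`, and the mass bounds
  have ha := a_ineq p ends o a₂ c b u hp
  have hδ := ToL_mul_D_le p hp ends o u a₂ c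
  have hMB' : prob p (TEvent ends u a₂ c ∩ connEvent ends u b ∩ (connEvent ends u o)ᶜ) ≤
      prob p (avoidAll ends u {a₂, c} ∩ (connEvent ends u o)ᶜ) :=
    prob_mono hp (Set.inter_subset_inter_left _
      (Set.inter_subset_left.trans (T_subset_R ends a₂ c u)))
  have hMB1 : prob p (TEvent ends u a₂ c ∩ (connEvent ends u o ∩ connEvent ends u b)) ≤
      prob p (TEvent ends u a₂ c ∩ connEvent ends u b) :=
    prob_mono hp (Set.inter_subset_inter_right _ Set.inter_subset_right)
  have hYND : prob p (PDEvent ends u a₂ c ∩ connEvent ends u o) ≤ prob p (PDEvent ends u a₂ c) :=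
    prob_mono hp Set.inter_subset_left
  have hYtt : prob p (TEvent ends u a₂ c ∩ connEvent ends u o) ≤ prob p (TEvent ends u a₂ c) :=
    prob_mono hp Set.inter_subset_left
  -- the mass bound `P(T, bL) − P(T, oL, bL) ≤ P(R) − P(R, oL)`
  have hMB : prob p (TEvent ends u a₂ c ∩ connEvent ends u b) -
      prob p (TEvent ends u a₂ c ∩ (connEvent ends u o ∩ connEvent ends u b)) ≤
      (prob p (PDEvent ends u a₂ c) + prob p (TEvent ends u a₂ c)) -
        (prob p (PDEvent ends u a₂ c ∩ connEvent ends u o) +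
          prob p (TEvent ends u a₂ c ∩ connEvent ends u o)) := by
    linarith [c6, hMB', c3, hW, hY]
  -- the complement masses of `(b)` in terms of the pattern masses
  have d1 : prob p (PDEvent ends u a₂ c ∩ (connEvent ends u o)ᶜ) =
      prob p (PDEvent ends u a₂ c) - prob p (PDEvent ends u a₂ c ∩ connEvent ends u o) := by
    linarith [c1]
  have d2 : prob p (avoidAll ends a₂ {u} ∩ connEvent ends u b ∩ (connEvent ends u o)ᶜ) =
      prob p (avoidAll ends a₂ {u} ∩ connEvent ends u b) -
        prob p (avoidAll ends a₂ {u} ∩ (connEvent ends u o ∩ connEvent ends u b)) := by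
    linarith [c2]
  have d3 : prob p (avoidAll ends u {a₂, c} ∩ (connEvent ends u o)ᶜ) =
      prob p (avoidAll ends u {a₂, c}) - prob p (avoidAll ends u {a₂, c} ∩ connEvent ends u o) := by
    linarith [c3]
  have d4 : prob p (PDEvent ends u a₂ c ∩ connEvent ends u b ∩ (connEvent ends u o)ᶜ) =
      prob p (PDEvent ends u a₂ c ∩ connEvent ends u b) -
        prob p (PDEvent ends u a₂ c ∩ (connEvent ends u o ∩ connEvent ends u b)) := by
    linarith [c4]
  have d5 : prob p (TEvent ends a₂ u c ∩ connEvent ends u b ∩ (connEvent ends u o)ᶜ) =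
      prob p (TEvent ends a₂ u c ∩ connEvent ends u b) -
        prob p (TEvent ends a₂ u c ∩ (connEvent ends u o ∩ connEvent ends u b)) := by
    linarith [c5]
  rw [d1, d2, d3, d4, d5] at hb
  -- rewrite everything into the eleven masses and close by the algebra
  rw [hW, hY, hB, hBo] at hb ha
  rw [hW, hY, hZ, hB]
  exact fw_of_b_alg (prob_nonneg hp _) (prob_nonneg hp _) (prob_nonneg hp _) (prob_nonneg hp _)
    (prob_nonneg hp _) hYND hYtt hMB1 hMB ha hδ hb

/-- **`(YB) ≥ 0` from `(b)`**. -/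
theorem YB_nonneg_of_b (hp : IsProbVec p)
    (hb : prob p (PDEvent ends u a₂ c ∩ (connEvent ends u o)ᶜ) *
        prob p (avoidAll ends a₂ {u} ∩ connEvent ends u b ∩ (connEvent ends u o)ᶜ) *
        prob p (avoidAll ends u {a₂, c} ∩ connEvent ends u o) ≤
      (prob p (PDEvent ends u a₂ c ∩ connEvent ends u b ∩ (connEvent ends u o)ᶜ) +
          prob p (TEvent ends a₂ u c ∩ connEvent ends u b ∩ (connEvent ends u o)ᶜ)) *
        prob p (PDEvent ends u a₂ c ∩ connEvent ends u o) *
        prob p (avoidAll ends u {a₂, c} ∩ (connEvent ends u o)ᶜ)) :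
    0 ≤ (prob p (avoidAll ends a₂ {c}) * prob p (avoidAll ends a₂ {u}) + prob p (PDEvent ends u a₂ c)) *
          prob p (TEvent ends u a₂ c ∩ (connEvent ends u o ∩ connEvent ends u b)) +
        prob p (PDEvent ends u a₂ c ∩ connEvent ends u o) *
          (prob p (PDEvent ends u a₂ c ∩ connEvent ends u b) +
            prob p (TEvent ends a₂ u c ∩ connEvent ends u b)) -
        prob p (avoidAll ends a₂ {c}) * prob p (avoidAll ends a₂ {u} ∩ connEvent ends u b) *
          (prob p (PDEvent ends u a₂ c ∩ connEvent ends u o) +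
            prob p (TEvent ends u a₂ c ∩ connEvent ends u o)) :=
  YB_nonneg_of_FW p ends o a₂ c b u hp (FW_of_b p ends o a₂ c b u hp hb)

/-- **`0 ≤ T2oL` from `(b)`**. -/
theorem T2oL_nonneg_of_b (hp : IsProbVec p)
    (hb : prob p (PDEvent ends u a₂ c ∩ (connEvent ends u o)ᶜ) *
        prob p (avoidAll ends a₂ {u} ∩ connEvent ends u b ∩ (connEvent ends u o)ᶜ) *
        prob p (avoidAll ends u {a₂, c} ∩ connEvent ends u o) ≤
      (prob p (PDEvent ends u a₂ c ∩ connEvent ends u b ∩ (connEvent ends u o)ᶜ) +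
          prob p (TEvent ends a₂ u c ∩ connEvent ends u b ∩ (connEvent ends u o)ᶜ)) *
        prob p (PDEvent ends u a₂ c ∩ connEvent ends u o) *
        prob p (avoidAll ends u {a₂, c} ∩ (connEvent ends u o)ᶜ)) :
    0 ≤ T2oL p ends o a₂ c b u :=
  T2oL_nonneg_of_FW p ends o a₂ c b u hp (FW_of_b p ends o a₂ c b u hp hb)

/-- **(G4-u) from `(b)` and the `o ∈ K` half** for the root `a₁` a leaf at the unmarked `u`. -/
theorem HCov_root_leaf_u_of_b (hp : IsProbVec p) {f : E} {a₁ : V} (hf : ends f = s(a₁, u))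
    (hleaf : ∀ e, a₁ ∈ ends e → e = f) (h1u : a₁ ≠ u) (h12 : a₁ ≠ a₂) (h1c : a₁ ≠ c)
    (h1o : a₁ ≠ o) (h1b : a₁ ≠ b)
    (hb : prob p (PDEvent ends u a₂ c ∩ (connEvent ends u o)ᶜ) *
        prob p (avoidAll ends a₂ {u} ∩ connEvent ends u b ∩ (connEvent ends u o)ᶜ) *
        prob p (avoidAll ends u {a₂, c} ∩ connEvent ends u o) ≤
      (prob p (PDEvent ends u a₂ c ∩ connEvent ends u b ∩ (connEvent ends u o)ᶜ) +
          prob p (TEvent ends a₂ u c ∩ connEvent ends u b ∩ (connEvent ends u o)ᶜ)) *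
        prob p (PDEvent ends u a₂ c ∩ connEvent ends u o) *
        prob p (avoidAll ends u {a₂, c} ∩ (connEvent ends u o)ᶜ))
    (hK : 0 ≤ T2oK p ends o a₂ c b u) (h3 : HCov p ends o u a₂ c b) : HCov p ends o a₁ a₂ c b :=
  HCov_root_leaf_u_of_FW p ends o a₂ c b u hp hf hleaf h1u h12 h1c h1o h1b
    (FW_of_b p ends o a₂ c b u hp hb) hK h3

end ReductionB

end YBF

end RootLeafU

end Summit.Ventures.PercRepro2
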